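import Summits.BirchSwinnertonDyer.BirchSwinnertonDyer.Theorems.ManinLocalTwoThreeTwistDefectFactFree
import Summits.BirchSwinnertonDyer.Rank1Residual.ManinAdditive.HalfTranslateTwistStep
import Literature.NumberTheory.EllipticCurves.NeronIsogenyScalingHoldsProofs
import Literature.NumberTheory.EllipticCurves.ModularDegreeQuadraticTwistSemistableProofs
import Literature.NumberTheory.EllipticCurves.ModularDegreeQuadraticTwistValuation
import Literature.NumberTheory.Automorphic.HeckeTraceFormulaGL2Level
import HarnessLib

/-!
# MEMO-desc §72 (desc g47, T-desc-60): the Manin ratio of an exact twist pair, read on NEWFORM lattices (`BirchSharp`)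
# and on MODULAR DEGREES (the degree-balance fold rule)

Cell `bsd-f2-manin`, seat `desc` (LENS descent / visibility: `c_E` via modular degree, congruence modules,
Néron models under twist), generation 47 (`HOME/desc/g47/Sketch-desc-g47.lean` 9aa72861d5900d35, §1–§3 + the §4 fold rule),
landed by LEAD p1 g26 as TURNKEY T-desc-60, `--supports stmt-BirchSwinnertonDyer-22967` (helper; route `ManinLocalTwoThree`,
crux C2 `ManinOddAtFour`).  HONEST FRAMING: fact-free kernel theorems about lattice-optimal data; nothing here proves C2/C3,
Manin's conjecture or BSD.

§1 (72.A, fact-free, PROVED) `mem_periodLattice_iff_of_neronTwist`: for lattice-optimal data `D'` of `A`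
   and `D` of `C` whose NÉRON lattices satisfy `Λ_C = (r/s)·Λ_A` (`z ∈ Λ_C ↔ s r⁻¹ z ∈ Λ_A`, the shape of the
   tree's `neronLattice_mem_iff_of_twist_of_sq_eq` / `_pStar`), the NEWFORM lattices are proportional:
   `w ∈ L(f_C) ↔ (c_C/(r c_A))·s·w ∈ L(f_A)`.
§2 (72.B, fact-free, PROVED) `abs_c_eq_iff_birchSharp`: with both models globally minimal,
   `|c_C| = |c_A| ↔ BirchSharp` where `BirchSharp := ∀ w, w ∈ L(f_C) ↔ s r⁻¹ w ∈ L(f_A)` — "the twist acts on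
   newform lattices exactly as on Néron lattices".  (`←`: Néron integrality
   `integral_neronScaling_of_isGloballyMinimal_holds` applied to `(C, C)` and `(A, A)`.)
§3 (72.C) the specialisation to an exact quadratic-twist pair `C = u • (A ⊗ χ_d)`, `r¹²Δ_C = d⁶Δ_A`, `s² = d`.
§4 (72.E, PROVED) the corollary schema `abs_c_eq_of_degreeBalance` = the census-v4 degree-balance fold rule, and its
   instance on the tree's odd-`p` good-prime degree identity.  (The typed level-changing Watkins identities at `p = 2`,
   E-desc-248/249/250 of MEMO-desc §72.D, are statement-only census candidates and are NOT declared here; they belong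
   beside `Literature…ModularDegreeQuadraticTwistSemistableProofs` once proved.)
Census (BC5 witness, in-seat, Cremona `alldegphi` × `opt_man`): the identity
`deg_C/deg_A = (c_C/c_A)²·(|d|/r²)·ψ(N_C)/ψ(N_A)·S(C)/S(A)` holds on 91 908 / 91 908 directed exact member
pairs with both levels `< 10⁴` (all prime fundamental `d`, `|d| ≤ 60`) and on 1 020 052 / 1 020 052 with
levels `< 10⁵` (`d ∈ {−4, ±8, −3, 5, −7}`); 0 violations; the detector sees `c²` exactly (ratio histogram
`1 : 1 019 138`, `4^{±1} : 328+328`, `9^{±1} : 111+111`, `16^{±1} : 12+12`, `25^{±1} : 6+6` at `10⁵`).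
-/

set_option autoImplicit false
set_option linter.dupNamespace false

noncomputable section

open scoped Classical NumberField MatrixGroups ModularForm

namespace Summit.BirchSwinnertonDyer.BirchSwinnertonDyer.Theorems.ManinLocalTwoThree.TwistDefect.DegreeBalance

open WeierstrassCurve CongruenceSubgroup
  Literature.NumberTheory.EllipticCurves Literature.NumberTheory.EllipticCurves.ModularForms
  Summit.BirchSwinnertonDyer.Rank1Residual.ManinAdditive
  Literature.NumberTheory.Automorphic.HeckeTraceFormulaGL2Level

variable {A C : WeierstrassCurve ℚ} {N' N : ℕ} [NeZero N'] [NeZero N]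

/-! ## §1 (72.A) Newform lattices along a Néron-lattice proportionality -/

/-- **72.A.** Lattice-optimal data (`Λ = c·L(f)`) on both sides and `Λ_C = (r/s) Λ_A` force
`L(f_C) = (r c_A/(s c_C))·L(f_A)`: `w ∈ L(f_C) ↔ (c_C/(r c_A))·(s w) ∈ L(f_A)`.  Fact-free.
[cite: Pal2012, Lemma 3.1] [cite: Stevens1989, Thm 1.7] -/
theorem mem_periodLattice_iff_of_neronTwist
    (D' : ModularParametrizationData A N') (D : ModularParametrizationData C N)
    (hopt' : ∀ z ∈ D'.L.lattice, ∃ w ∈ periodLattice D'.f, z = D'.c * w)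
    (hopt : ∀ z ∈ D.L.lattice, ∃ w ∈ periodLattice D.f, z = D.c * w)
    {s : ℂ} (hs : s ≠ 0) {r : ℂ} (hr : r ≠ 0)
    (hΛ : ∀ z : ℂ, z ∈ D.L.lattice ↔ s * (r⁻¹ * z) ∈ D'.L.lattice) (w : ℂ) :
    w ∈ periodLattice D.f ↔ (D.c : ℂ) / (r * D'.c) * (s * w) ∈ periodLattice D'.f := by
  have hc : (D.c : ℂ) ≠ 0 := by exact_mod_cast D.maninConstant_ne_zero_holds
  have hc' : (D'.c : ℂ) ≠ 0 := by exact_mod_cast D'.maninConstant_ne_zero_holds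
  constructor
  · intro hw
    have h1 : (D.c : ℂ) * w ∈ D.L.lattice := D.smul_periodLattice_le w hw
    have h2 : s * (r⁻¹ * ((D.c : ℂ) * w)) ∈ D'.L.lattice := (hΛ _).mp h1
    obtain ⟨v, hv, hveq⟩ := hopt' _ h2
    have h3 : (D.c : ℂ) / (r * D'.c) * (s * w) = v := by
      rw [div_mul_eq_mul_div, div_eq_iff (mul_ne_zero hr hc')]
      have h4 : (D'.c : ℂ) * v * r = s * ((D.c : ℂ) * w) := by
        rw [← hveq]; field_simp
      linear_combination h4.symm
    rw [h3]; exact hv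
  · intro hv
    have h1 : (D'.c : ℂ) * ((D.c : ℂ) / (r * D'.c) * (s * w)) ∈ D'.L.lattice :=
      D'.smul_periodLattice_le _ hv
    have h2 : (D'.c : ℂ) * ((D.c : ℂ) / (r * D'.c) * (s * w)) = s * (r⁻¹ * ((D.c : ℂ) * w)) := by
      field_simp
    rw [h2] at h1
    have h3 : (D.c : ℂ) * w ∈ D.L.lattice := (hΛ _).mpr h1
    obtain ⟨w', hw', heq⟩ := hopt _ h3
    rw [mul_left_cancel₀ hc heq]; exact hw'

/-! ## §2 (72.B) `BirchSharp ↔ |c_C| = |c_A|` -/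

/-- **`BirchSharp`**: the twist acts on the NEWFORM lattices exactly as on the NÉRON lattices,
`s·L(f_C) = r·L(f_A)` in the orientation `Λ_C = (r/s)Λ_A`: `w ∈ L(f_C) ↔ s r⁻¹ w ∈ L(f_A)`.  For a
`χ`-twist with `s = g(χ)` the containment `g(χ)·L(f_C) ⊆ L(f_A)` (up to `r`) is Birch's lemma
(`gaussSum_mul_mem_periodLattice_of_mem_charTwist`); `BirchSharp` is its sharp (index-exact) form. -/
def BirchSharp (D' : ModularParametrizationData A N') (D : ModularParametrizationData C N) (s r : ℂ) : Prop :=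
  ∀ w : ℂ, w ∈ periodLattice D.f ↔ s * (r⁻¹ * w) ∈ periodLattice D'.f

/-- **72.B.** For globally minimal `A`, `C`, lattice-optimal data and `Λ_C = (r/s)Λ_A`:
`|c_C| = |c_A| ↔ BirchSharp`.  `→` is 72.A; `←`: `BirchSharp` makes `(c_A/c_C)·Λ_C ⊆ Λ_C` and
`(c_C/c_A)·Λ_A ⊆ Λ_A`, so both ratios are integers by Néron integrality
(`integral_neronScaling_of_isGloballyMinimal_holds`, a tree theorem).  Fact-free.
[cite: SilvermanATAEC1994, IV.5.1 with IV.6.1 and Cor. IV.9.1] [cite: Pal2012, Lemma 3.1] -/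
theorem abs_c_eq_iff_birchSharp [A.IsElliptic] [C.IsElliptic] [A.IsGloballyMinimal] [C.IsGloballyMinimal]
    (D' : ModularParametrizationData A N') (D : ModularParametrizationData C N)
    (hopt' : ∀ z ∈ D'.L.lattice, ∃ w ∈ periodLattice D'.f, z = D'.c * w)
    (hopt : ∀ z ∈ D.L.lattice, ∃ w ∈ periodLattice D.f, z = D.c * w)
    {s : ℂ} (hs : s ≠ 0) {r : ℂ} (hr : r ≠ 0)
    (hΛ : ∀ z : ℂ, z ∈ D.L.lattice ↔ s * (r⁻¹ * z) ∈ D'.L.lattice) :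
    |D.c| = |D'.c| ↔ BirchSharp D' D s r := by
  have hc0 : D.c ≠ 0 := D.maninConstant_ne_zero_holds
  have hc0' : D'.c ≠ 0 := D'.maninConstant_ne_zero_holds
  have hc : (D.c : ℂ) ≠ 0 := by exact_mod_cast hc0
  have hc' : (D'.c : ℂ) ≠ 0 := by exact_mod_cast hc0'
  have key := mem_periodLattice_iff_of_neronTwist D' D hopt' hopt hs hr hΛ
  constructor
  · intro habs w
    rw [key w]
    rcases abs_eq_abs.mp habs with h | h
    · have e : (D.c : ℂ) / (r * D'.c) * (s * w) = s * (r⁻¹ * w) := by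
        rw [h]; field_simp
      rw [e]
    · have e : (D.c : ℂ) / (r * D'.c) * (s * w) = -(s * (r⁻¹ * w)) := by
        rw [h]; push_cast; field_simp
      rw [e, neg_mem_iff]
  · intro hB
    -- `(c_A/c_C) Λ_C ⊆ Λ_C`
    have hCC : ∀ z ∈ D.L.lattice, (((D'.c : ℚ) / D.c : ℚ) : ℂ) * z ∈ D.L.lattice := by
      intro z hz
      obtain ⟨w, hw, rfl⟩ := hopt z hz
      have h1 : s * (r⁻¹ * w) ∈ periodLattice D'.f := (hB w).mp hw
      have h2 : (D'.c : ℂ) * (s * (r⁻¹ * w)) ∈ D'.L.lattice := D'.smul_periodLattice_le _ h1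
      have h3 : s * (r⁻¹ * ((D'.c : ℂ) * w)) ∈ D'.L.lattice := by
        have e : s * (r⁻¹ * ((D'.c : ℂ) * w)) = (D'.c : ℂ) * (s * (r⁻¹ * w)) := by ring
        rw [e]; exact h2
      have h4 : (D'.c : ℂ) * w ∈ D.L.lattice := (hΛ _).mpr h3
      have e : (((D'.c : ℚ) / D.c : ℚ) : ℂ) * ((D.c : ℂ) * w) = (D'.c : ℂ) * w := by
        push_cast; field_simp
      rw [e]; exact h4
    -- `(c_C/c_A) Λ_A ⊆ Λ_A`
    have hAA : ∀ z ∈ D'.L.lattice, (((D.c : ℚ) / D'.c : ℚ) : ℂ) * z ∈ D'.L.lattice := by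
      intro z hz
      obtain ⟨v, hv, rfl⟩ := hopt' z hz
      have hvw : s * (r⁻¹ * (r * (s⁻¹ * v))) = v := by field_simp
      have hw : r * (s⁻¹ * v) ∈ periodLattice D.f := (hB _).mpr (by rw [hvw]; exact hv)
      have h1 : (D.c : ℂ) * (r * (s⁻¹ * v)) ∈ D.L.lattice := D.smul_periodLattice_le _ hw
      have h2 : s * (r⁻¹ * ((D.c : ℂ) * (r * (s⁻¹ * v)))) ∈ D'.L.lattice := (hΛ _).mp h1
      have e : (((D.c : ℚ) / D'.c : ℚ) : ℂ) * ((D'.c : ℂ) * v) = s * (r⁻¹ * ((D.c : ℂ) * (r * (s⁻¹ * v)))) := by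
        push_cast; field_simp
      rw [e]; exact h2
    obtain ⟨k, hk⟩ := integral_neronScaling_of_isGloballyMinimal_holds C C D.L D.L D.isNeronLattice
      D.isNeronLattice _ hCC
    obtain ⟨k', hk'⟩ := integral_neronScaling_of_isGloballyMinimal_holds A A D'.L D'.L D'.isNeronLattice
      D'.isNeronLattice _ hAA
    have hq0 : (D.c : ℚ) ≠ 0 := by exact_mod_cast hc0
    have hq0' : (D'.c : ℚ) ≠ 0 := by exact_mod_cast hc0'
    have e1 : k * D.c = D'.c := by
      have h : (k : ℚ) * D.c = D'.c := by rw [hk]; field_simp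
      exact_mod_cast h
    have e2 : k' * D'.c = D.c := by
      have h : (k' : ℚ) * D'.c = D.c := by rw [hk']; field_simp
      exact_mod_cast h
    have hd1 : D.c ∣ D'.c := ⟨k, by rw [mul_comm]; exact e1.symm⟩
    have hd2 : D'.c ∣ D.c := ⟨k', by rw [mul_comm]; exact e2.symm⟩
    have hn : D.c.natAbs = D'.c.natAbs :=
      Nat.dvd_antisymm (Int.natAbs_dvd_natAbs.mpr hd1) (Int.natAbs_dvd_natAbs.mpr hd2)
    rw [Int.abs_eq_natAbs, Int.abs_eq_natAbs, hn]

/-! ## §3 (72.C) The exact quadratic-twist pair -/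

/-- **72.C.** For an exact twist pair `C = u • (A ⊗ χ_d)` with defect `r` (`r¹² Δ_C = d⁶ Δ_A`,
`r ∈ {1, q}` for prime `|d| = q`, `r ∈ {1, 2, 4, 8}` dyadically) and `s² = d`, both models globally
minimal and both data lattice-optimal: `|c_C| = |c_A| ↔ BirchSharp D' D s r`.  The Néron-lattice
relation is the tree's `neronLattice_mem_iff_of_twist_of_sq_eq`.  Fact-free.
[cite: Pal2012, Lemma 3.1] [cite: SilvermanATAEC1994, Cor. IV.9.1] -/
theorem abs_c_eq_iff_birchSharp_of_twist [A.IsElliptic] [C.IsElliptic] [A.IsGloballyMinimal]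
    [C.IsGloballyMinimal]
    (D' : ModularParametrizationData A N') (D : ModularParametrizationData C N)
    (hopt' : ∀ z ∈ D'.L.lattice, ∃ w ∈ periodLattice D'.f, z = D'.c * w)
    (hopt : ∀ z ∈ D.L.lattice, ∃ w ∈ periodLattice D.f, z = D.c * w)
    {d : ℚ} (hd : d ≠ 0) (u : VariableChange ℚ) (hu : u • A.quadraticTwist d = C)
    {r : ℚ} (hr : r ≠ 0) (hΔ : r ^ 12 * C.Δ = d ^ 6 * A.Δ) {s : ℂ} (hs2 : s ^ 2 = (d : ℂ)) :
    |D.c| = |D'.c| ↔ BirchSharp D' D s (r : ℂ) := by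
  have hd0 : (d : ℂ) ≠ 0 := by exact_mod_cast hd
  have hs : s ≠ 0 := fun h0 ↦ hd0 (by rw [← hs2, h0]; simp)
  have hr' : ((r : ℚ) : ℂ) ≠ 0 := by exact_mod_cast hr
  exact abs_c_eq_iff_birchSharp D' D hopt' hopt hs hr'
    (fun z ↦ neronLattice_mem_iff_of_twist_of_sq_eq hd u hu hΔ hs2 D'.isNeronLattice D.isNeronLattice z)

/-- **72.C′ (the transport rule).** Same hypotheses: `BirchSharp` and `|c_A| = 1` give `|c_C| = 1`, in
EITHER direction of the twist (no locus, level-divisibility or orientation hypothesis). -/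
theorem abs_c_eq_one_of_birchSharp_of_twist [A.IsElliptic] [C.IsElliptic] [A.IsGloballyMinimal]
    [C.IsGloballyMinimal]
    (D' : ModularParametrizationData A N') (D : ModularParametrizationData C N)
    (hopt' : ∀ z ∈ D'.L.lattice, ∃ w ∈ periodLattice D'.f, z = D'.c * w)
    (hopt : ∀ z ∈ D.L.lattice, ∃ w ∈ periodLattice D.f, z = D.c * w)
    {d : ℚ} (hd : d ≠ 0) (u : VariableChange ℚ) (hu : u • A.quadraticTwist d = C)
    {r : ℚ} (hr : r ≠ 0) (hΔ : r ^ 12 * C.Δ = d ^ 6 * A.Δ) {s : ℂ} (hs2 : s ^ 2 = (d : ℂ))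
    (hB : BirchSharp D' D s (r : ℂ)) (h1 : |D'.c| = 1) : |D.c| = 1 := by
  rw [(abs_c_eq_iff_birchSharp_of_twist D' D hopt' hopt hd u hu hr hΔ hs2).mpr hB, h1]

/-! ## §4 (72.E) The degree-balance fold rule

Tree status (read 2026-08-31): `ModularDegreeQuadraticTwistProofs` (odd `p`, both additive, common level,
`V = p`), `ModularDegreeQuadraticTwistSemistableProofs` (odd `p`, `A` good: `V = (p−1)((p+1)²−a_p²)`,
`N = p²M`; `A` multiplicative: `V = p² − 1`, `N = pM`), `ModularDegreeQuadraticTwistValuation` (`p = 2`,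
common level, `d ∈ {−1, ±2}`: `deg′c²u² = |d|·deg·c′²`).  MISSING: any two-level statement at `p = 2`
(`rankinResidue_eq_mul_of_twist` carries `hp2 : p ≠ 2`) — typed as census candidates E-desc-248/249/250 (MEMO-desc
§72.D), not declared here.  Whatever the local factor `V`, the fold rule below turns the identity plus the `c`-free
degree balance into `|c_C| = |c_A|`. -/

/-- **E-desc-251 (the degree-balance fold rule, PROVED schema).** Whatever the local factor `V ≠ 0`: the
identity `deg_C · c_A² · u² = V · deg_A · c_C²` together with the `c`-FREE balance
`deg_C · u² = V · deg_A` (a finite check on the modular-degree table) gives `|c_C| = |c_A|`; with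
`|c_A| = 1` known, `|c_C| = 1` — in either direction of the twist. -/
theorem abs_c_eq_of_degreeBalance (D' : ModularParametrizationData A N') (D : ModularParametrizationData C N)
    {V U : ℚ} (hU : U ≠ 0)
    (hid : (D.deg : ℚ) * (D'.c : ℚ) ^ 2 * U = V * (D'.deg : ℚ) * (D.c : ℚ) ^ 2)
    (hbal : (D.deg : ℚ) * U = V * (D'.deg : ℚ)) : |D.c| = |D'.c| := by
  have hdeg : (0 : ℚ) < D.deg := by exact_mod_cast D.deg_pos
  have hX : (D.deg : ℚ) * U ≠ 0 := mul_ne_zero hdeg.ne' hU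
  have h : ((D'.c : ℚ)) ^ 2 * ((D.deg : ℚ) * U) = ((D.c : ℚ)) ^ 2 * ((D.deg : ℚ) * U) := by
    linear_combination hid - ((D.c : ℚ)) ^ 2 * hbal
  have h2 : ((D'.c : ℚ)) ^ 2 = ((D.c : ℚ)) ^ 2 := mul_right_cancel₀ hX h
  have h3 : |(D.c : ℚ)| = |(D'.c : ℚ)| := (sq_eq_sq_iff_abs_eq_abs _ _).mp h2.symm
  exact_mod_cast h3

/-- E-desc-251 applied: `|c_A| = 1` and balance give `|c_C| = 1`. -/
theorem abs_c_eq_one_of_degreeBalance (D' : ModularParametrizationData A N')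
    (D : ModularParametrizationData C N) {V U : ℚ} (hU : U ≠ 0)
    (hid : (D.deg : ℚ) * (D'.c : ℚ) ^ 2 * U = V * (D'.deg : ℚ) * (D.c : ℚ) ^ 2)
    (hbal : (D.deg : ℚ) * U = V * (D'.deg : ℚ)) (h1 : |D'.c| = 1) : |D.c| = 1 := by
  rw [abs_c_eq_of_degreeBalance D' D hU hid hbal, h1]

/-- Instance of the fold rule on the tree's odd-`p` GOOD-prime theorem (the UP-edges at `3` from the
semistable roots `14a, 15a, 30a, 42a, 70a, …`): `A` globally minimal and good at the odd prime `p`, `C` a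
globally minimal model of `A ⊗ χ_{p*}` with `|u| = 1`, data at levels `M` (`p ∤ M`) and `p²M`; if
`deg_C = (p − 1)((p + 1)² − a_p²)·deg_A` then `|c_C| = |c_A|`.  PROVED from the tree. -/
theorem abs_c_eq_of_deg_eq_of_good [A.IsElliptic] {p : ℕ} [Fact p.Prime] (hp2 : p ≠ 2) {M : ℕ}
    [NeZero M]
    (hgood : A.HasGoodReductionAtPrime p) (u : VariableChange ℚ)
    (hu : u • A.quadraticTwist (((-1 : ℤ) ^ (p / 2) * p : ℤ) : ℚ) = C) (habs : |(u.u : ℚ)| = 1)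
    (hC0 : ∀ n : ℕ, p ∣ n → C.LFunction n = 0)
    (D' : ModularParametrizationData A M) (D : ModularParametrizationData C N)
    (hM : ¬ p ∣ M) (hN : N = p ^ 2 * M)
    (hbal : (D.deg : ℤ) = ((p : ℤ) - 1) * (((p : ℤ) + 1) ^ 2 - A.LFunction p ^ 2) * D'.deg) :
    |D.c| = |D'.c| := by
  have hid := ModularParametrizationData.deg_mul_sq_eq_of_quadraticTwist_pStar_of_hasGoodReductionAtPrime_of_abs_u_eq_one
    hp2 hgood u hu habs hC0 D' D hM hN
  set V : ℤ := ((p : ℤ) - 1) * (((p : ℤ) + 1) ^ 2 - A.LFunction p ^ 2) with hV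
  have hidQ : (D.deg : ℚ) * (D'.c : ℚ) ^ 2 * 1 = (V : ℚ) * (D'.deg : ℚ) * (D.c : ℚ) ^ 2 := by
    rw [mul_one]; exact_mod_cast hid
  have hbalQ : (D.deg : ℚ) * 1 = (V : ℚ) * (D'.deg : ℚ) := by rw [mul_one]; exact_mod_cast hbal
  exact abs_c_eq_of_degreeBalance D' D one_ne_zero hidQ hbalQ

end Summit.BirchSwinnertonDyer.BirchSwinnertonDyer.Theorems.ManinLocalTwoThree.TwistDefect.DegreeBalance

end
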